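import Mathlib.RepresentationTheory.Homological.GroupCohomology.Functoriality
import Mathlib.Data.Fin.VecNotation
import Literature.AlgebraicGeometry.HodgeTheory.LocallyTrivialExtensionClasses
import Summits.HodgeConjecture.HodgeConjecture.Theorems.LinearSystemTorelliLocalTubeSpanAlgebra

/-!
# Route LinearSystemTorelli — crux `LocalTubeSpan` (stmt-HodgeConjecture-2490): pairing three is detected by a word

Helper file (`--supports stmt-HodgeConjecture-2490`, line `Sketch` of the crux chain, cycle 4,
stub `stub_rankTwoPairingThree`).  The cycle-3 THIN BOUNDARY
(`localTubeSpan_exists_thinConfiguration_not_injective`, file `…Thin`) shows that for the integral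
symplectic transvections along the triangle `δ₁, δ₂, δ₁ + δ₂` with `⟨δ₁, δ₂⟩ = 4` Schnell's third
map `H¹(G, ℚ²) → ∏_g ℚ²/(g - 1)ℚ²` is NOT injective, and `…RankTwoPairingTwo` shows that with
pairing `2` it is (frame argument).  This file settles pairing `3`, correcting the informal
cycle-3 remark "the thin regime starts at `|⟨δ, δ'⟩| = 3`":

* `localTubeSpan_injective_evalCoinv_rankTwoPairingThree` — for ANY group generated by three
  elements acting on `ℚ²` as `T₁(v) = (v₀ + 3v₁, v₁)`, `T₂(v) = (v₀, v₁ - 3v₀)`,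
  `T₃(v) = v - 3(v₀ - v₁)(1, 1)` (transvections of `3(x₀y₁ - x₁y₀)` along `(1,0), (0,1), (1,1)`),
  the third map IS injective.

The mechanism is new to the line — neither a finite-index frame (`⟨T₁, T₂⟩` is the thin Sanov-type
group of parameter `3`, of infinite index in `SL₂(ℤ)`, and no power of `T₃` lies in it) nor
normal-crossing rank drop: the three matrices generate the arithmetic group `Γ(3)` (four cusps,
no weight-3 cusp forms), and the product WORD `τ₂ τ₀ τ₁` acts as the unipotent
`(7 -3; 12 -5)` at the fourth cusp `(1, 2)`.  An undetected cocycle has `φ(τ₀) = (a₀, 0)`,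
`φ(τ₁) = (0, a₁)`, `φ(τ₂) = (a₂, a₂)`, and undetectedness at the word,
`φ(τ₂τ₀τ₁) = (a₂ - 2a₀ - 3a₁, a₂ - 3a₀ - 5a₁) ∈ ℚ(1, 2)`, forces `a₂ = a₀ + a₁` — exactly the
condition for `φ` to agree on the generators with the coboundary of `x = (-a₁/3, a₀/3)`.
(Exact computation, item evidence `mu_triangle.py`: pairings `1, 2, 3` detected by words of length
`≤ 6`; pairings `4, 5, 6` leave a one-dimensional undetected space up to length `6`.)  In the route:
local PAIRS `(g, α)` with `g` a product of meridians, as the planner anticipated at normal-crossing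
points, are a genuine third source of detection.
-/

-- `Summit.HodgeConjecture.HodgeConjecture.Theorems` is the mandated namespace (single-conjunct summit:
-- Sub = Summit), which `linter.dupNamespace` flags on every declaration; the lakefile turns the
-- linter off tree-wide (weak option), restated here so stand-alone elaboration is warning-free too.
set_option linter.dupNamespace false

noncomputable section

open CategoryTheory groupCohomology
open Literature.AlgebraicGeometry.HodgeTheory

namespace Summit.HodgeConjecture.HodgeConjecture.Theorems

/-- **Pairing three is detected (by a word).**  Let a group `G` be generated by three elements
`τ 0, τ 1, τ 2` acting on `ℚ²` as `T₁(v) = (v₀ + 3v₁, v₁)`, `T₂(v) = (v₀, v₁ - 3v₀)`,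
`T₃(v) = v - 3(v₀ - v₁)(1, 1)`.  Then Schnell's third map `H¹(G, ℚ²) → ∏_g ℚ²/(g - 1)ℚ²` is
injective: undetectedness on the generators gives `φ(τ₀) = (a₀, 0)`, `φ(τ₁) = (0, a₁)`,
`φ(τ₂) = (a₂, a₂)`; undetectedness at the word `τ₂ τ₀ τ₁` (a unipotent with fixed direction
`(1, 2)`) gives `a₂ = a₀ + a₁`; and then `φ = d x` on the generators for `x = (-a₁/3, a₀/3)`,
hence on `G`. [folklore] -/
theorem localTubeSpan_injective_evalCoinv_rankTwoPairingThree {G : Type} [Group G]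
    (ρ : Representation ℚ G (Fin 2 → ℚ)) (τ : Fin 3 → G)
    (hgen : Subgroup.closure (Set.range τ) = ⊤)
    (hτ₀ : ∀ v, ρ (τ 0) v = ![v 0 + 3 * v 1, v 1])
    (hτ₁ : ∀ v, ρ (τ 1) v = ![v 0, v 1 - 3 * v 0])
    (hτ₂ : ∀ v, ρ (τ 2) v = ![v 0 - 3 * (v 0 - v 1), v 1 - 3 * (v 0 - v 1)]) :
    Function.Injective (evalCoinv (Rep.of ρ)) := by
  classical
  refine (injective_iff_map_eq_zero _).2 fun ξ hξ => ?_
  induction ξ using H1_induction_on with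
  | h φ =>
    -- undetectedness: every value is `(g - 1) y` for some `y`
    have hφ : ∀ g : G, ∃ y : Fin 2 → ℚ, ρ g y - y = (φ : G → Fin 2 → ℚ) g := fun g => by
      have := congr_fun hξ g
      rw [evalCoinv_H1π, Pi.zero_apply, Submodule.mkQ_apply, Submodule.Quotient.mk_eq_zero]
        at this
      obtain ⟨y, hy⟩ := this
      exact ⟨y, hy⟩
    -- the values on the three generators
    set u : Fin 2 → ℚ := (φ : G → Fin 2 → ℚ) (τ 0) with hudef
    set v : Fin 2 → ℚ := (φ : G → Fin 2 → ℚ) (τ 1) with hvdef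
    set w : Fin 2 → ℚ := (φ : G → Fin 2 → ℚ) (τ 2) with hwdef
    have hu1 : u 1 = 0 := by
      obtain ⟨y, hy⟩ := hφ (τ 0)
      have h := congr_fun hy 1
      rw [hτ₀] at h
      simp at h
      rw [← hudef] at h
      linarith
    have hv0 : v 0 = 0 := by
      obtain ⟨y, hy⟩ := hφ (τ 1)
      have h := congr_fun hy 0
      rw [hτ₁] at h
      simp at h
      rw [← hvdef] at h
      linarith
    have hw01 : w 0 = w 1 := by
      obtain ⟨y, hy⟩ := hφ (τ 2)
      have h0 := congr_fun hy 0
      have h1 := congr_fun hy 1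
      rw [hτ₂] at h0 h1
      simp at h0 h1
      rw [← hwdef] at h0 h1
      linarith
    -- the cocycle at the word `τ 2 * τ 0 * τ 1`
    have hcoc := (mem_cocycles₁_iff φ).1 φ.2
    have hword : (φ : G → Fin 2 → ℚ) (τ 2 * τ 0 * τ 1) =
        ρ (τ 2) (ρ (τ 0) v) + (ρ (τ 2) u + w) := by
      rw [hcoc (τ 2 * τ 0) (τ 1), hcoc (τ 2) (τ 0)]
      change ρ (τ 2 * τ 0) v + (ρ (τ 2) u + w) = _
      rw [map_mul, Module.End.mul_apply]
    -- undetectedness at the word forces `a₂ = a₀ + a₁`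
    have key : w 0 = u 0 + v 1 := by
      obtain ⟨z, hz⟩ := hφ (τ 2 * τ 0 * τ 1)
      rw [hword, map_mul, map_mul, Module.End.mul_apply, Module.End.mul_apply] at hz
      have h0 := congr_fun hz 0
      have h1 := congr_fun hz 1
      simp only [hτ₀, hτ₁, hτ₂, Pi.sub_apply, Pi.add_apply, Matrix.cons_val_zero,
        Matrix.cons_val_one] at h0 h1
      rw [hu1, hv0] at h0 h1
      rw [← hw01] at h1
      linarith
    -- the primitive
    let x : Fin 2 → ℚ := ![-(v 1) / 3, u 0 / 3]
    have hx0 : x 0 = -(v 1) / 3 := rfl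
    have hx1 : x 1 = u 0 / 3 := rfl
    have hgenx : ∀ g ∈ Set.range τ, ρ g x - x = (φ : G → Fin 2 → ℚ) g := by
      rintro _ ⟨i, rfl⟩
      match i with
      | 0 =>
        change ρ (τ 0) x - x = u
        rw [hτ₀]
        ext j
        fin_cases j
        · simp [hx0, hx1]; ring
        · simp [hx1, hu1]
      | 1 =>
        change ρ (τ 1) x - x = v
        rw [hτ₁]
        ext j
        fin_cases j
        · simp [hx0, hv0]
        · simp [hx0, hx1]; ring
      | 2 =>
        change ρ (τ 2) x - x = w
        rw [hτ₂]
        ext j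
        fin_cases j
        · simp [hx0, hx1]; linarith
        · simp [hx0, hx1]; linarith
    -- `φ = d x` on the generators, hence its class restricts to zero on `⟨τ⟩ = G`
    have hmem : H1π (Rep.of ρ) φ ∈ H1resKer (Rep.of ρ) (Subgroup.closure (Set.range τ)) :=
      (localTubeSpan_H1resKer_closure_mk_iff (Rep.of ρ) (Set.range τ) φ).2 ⟨x, hgenx⟩
    rwa [hgen, H1resKer_top, Submodule.mem_bot] at hmem

end Summit.HodgeConjecture.HodgeConjecture.Theorems

end
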